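import Mathlib
import HarnessLib
import Summits.BirchSwinnertonDyer.BirchSwinnertonDyer.Theorems.SylvesterTwoHeegnerIndexUnramifiedQuadraticDescent

/-!
# Route `SylvesterTwoHeegnerIndex` (rung K7t): the `ℤ₂[ω][C₂]`-linear algebra of ROAD (k), PART II —
# cohomological triviality, unit eigenlines, the `𝒪`-sesquilinear refinement of an `𝒪`-balanced
# pairing, base-changed Lagrangians

Cell `bsd-cm`, seat `bsd-cm-k7t-c2` (prover-bsd-cm-k7t-c2-g14-0; hand item 19229
`HeegnerIndexUpperAtTwoHSY`: verdict unchanged, NOT FOUND as a theorem — fact-free, equivalent modulo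
the route's facts to `MissingUpperBoundAt B 2`, open as a class). PARTITION (D-0054): CornerF at `p = 2`
(B14/O12) × 𝒞_HSY (`E_p : x³ + y³ = p`) × `p = 2` — types-the-object-of: the pure algebra used by the
`𝒪`-linear Kolyvagin argument over the CM field `K = ℚ(ω)` at the inert prime `2` (ROAD (k): line card
`Cruxes/UpperOffV0HSYPlus/Lines/cmframe-kolyvagin2.md`, skeleton of record VARIANT J
`Cruxes/UpperOffV0HSYPlus/Lines/coupled_variantJ.lean`, stubs (K3-4)/(K3-7) = THEOREM K3 / K3* typed)
BEYOND the descent lemma of Part I (`…Theorems/SylvesterTwoHeegnerIndexUnramifiedQuadraticDescent`,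
p553247, LEMMA D ≡ LEMMA K0). Kernel helper `--supports stmt-BirchSwinnertonDyer-19804 --as helper`;
closes no cell and no item; BSD is not claimed; THEOREM K3 stays a PAPER theorem (memo two v2.18
§64–§66, refereed g61) — nothing below is an Euler-system statement. Everything is PROVED abstract
algebra over Mathlib: no definition, no named fact, no instance, no notation, no `sorry`.

SETTING (as in Part I): an additive commutative group `M`, an additive endomorphism `w` with
`w² + w + 1 = 0` (a `ℤ[ω]`-module), an additive involution `σ` with `σ w = w̄ σ`, `w̄ = −1 − w`
(conjugation acting semilinearly); `S = ker (σ − id)`, `T = ker (σ + id)`, `θ = id + 2w`. Where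
needed, `3` acts injectively/bijectively (automatic on `2`-primary torsion, Part I).

WHAT IS PROVED, AND WHERE ROAD (k) USES IT (memo two = `HOME/MEMO-bsd-cm-two.md` v2.20; [McC91] =
W. G. McCallum, *Kolyvagin's work on Shafarevich–Tate groups*, LMS LN 153 (1991) 295–316, §3, §5).
* §A COHOMOLOGICAL TRIVIALITY of `M` as a `⟨σ⟩`-module: `range (σ + id) = ker (σ − id)` and
  `range (σ − id) = ker (σ + id)` (`Ĥ⁰ = H¹ = 0`; no hypothesis on `3`: an invariant `s` is the norm of
  `−w s`, an anti-invariant `t` is `σ(w t) − w t`; `ℤ[ω] = ℤω ⊕ ℤω̄ ≅ ℤ[C₂]` is induced). USE: memo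
  §64.2 (C4) «`{ρ^τρ} = (1 + τ)H = H^τ`, `Tr : 𝒪/2^M → ℤ/2^M` onto» — the replacement for [McC91 §3]
  «since `|Gal(L_C/L)|` is odd»; and `H¹(Gal(K/ℚ), ·) = 0` behind §57.1 (D1).
* §B UNIT EIGENLINES: `{σ x = [u] x} = [λ_u]·S` resp. `[λ_u]·T` for `u ∈ {ω, ω̄, −ω, −ω̄}`,
  `λ_ω = ω`, `λ_{ω̄} = ω̄` (with Part I's `T = θ S`: all six `τ`-eigenlines, `u ∈ μ₆`, are unit
  multiples of `S`). USE: memo §57.1 (D2) «every `τ`-eigenclass is a unit multiple of a class over `ℚ`».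
* §C THE `𝒪`-SESQUILINEAR REFINEMENT of a biadditive `B : M × M → Q` that is `𝒪`-BALANCED,
  `B(ωa, b) = B(a, ω̄b)` (Cassels–Tate / local Tate pairings under the CM isogenies `[α]`, `[ᾱ]`):
  with `R₀ := B(a,b) − B(ωa,b)`, `R₁ := −B(a,b) − 2B(ωa,b)` (displayed, not defined), `R₀ + ωR₁`
  is `3×` the unique `𝒪`-sesquilinear `(( , ))` with `Tr ∘ (( , )) = B` (`Tr(x + ωy) = 2x − y`):
  trace identity, `ω`-linear left / `ω̄`-linear right, alternating ⇒ skew-hermitian, uniqueness, and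
  the KERNEL statements `refine_eq_zero_iff` (`((a,b)) = 0 ↔ B(a,b) = B(ωa,b) = 0` — the «unit
  adjustment»), `refine_left/right_kernel_iff` (`(( , ))` non-degenerate iff `B` is). USE: memo §59.1
  (i) (existence / uniqueness / perfectness of `(( , ))` on `Ш(X/K)[2^∞]`) and §64.1 (P6), §64.4 (13)
  «for the `ℚ/ℤ`-valued pairing the statement is FALSE over `𝒪/2^M` (`Tr(1/2) ≡ 0`); the sesquilinear
  refinement is exactly what repairs it», «`Tr(ū((d,y))) ≠ 0` for some unit `u ∈ μ₃`» — the two steps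
  the memo lists as the non-verbatim scalar bookkeeping of [McC91 §5].
* §D BASE-CHANGED LAGRANGIANS: `B(D₀,D₀) = B(D₀,ωD₀) = 0 ⇒ D₀ ⊔ ωD₀` is `B`-isotropic, `ω`-stable,
  `σ`-stable and of order `#D₀²` when `D₀ ≤ S`; with Part I's `#M = #S²`: `#D₀² = #S ⇒
  #(D₀ ⊔ ωD₀)² = #M`. USE: memo §59.1 (iii) «`D^X := D₀ ⊗ 𝒪₂ = res D₀ + ω·res D₀` is a maximal
  isotropic `𝒪`-submodule» — the replacement for [McC91 §5] «a maximal isotropic `D = D₁ × D₂ × ⋯`».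
-/

set_option autoImplicit false
set_option linter.dupNamespace false

namespace Summit.BirchSwinnertonDyer.BirchSwinnertonDyer.Theorems.SylvesterTwoUnramifiedPairings

open Summit.BirchSwinnertonDyer.BirchSwinnertonDyer.Theorems.SylvesterTwoUnramifiedDescent

variable {M : Type*} [AddCommGroup M]

/-! ### Preliminaries on `w` -/

/-- `w² = w̄`: `w (w x) = −x − w x`. -/
theorem w_w_eq (w : M →+ M) (hw : ∀ x, w (w x) + w x + x = 0) (x : M) :
    w (w x) = -x - w x := by
  rw [← sub_eq_zero, ← hw x]; abel

/-- `w³ = 1`. -/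
theorem w_w_w_eq (w : M →+ M) (hw : ∀ x, w (w x) + w x + x = 0) (x : M) : w (w (w x)) = x := by
  rw [w_w_eq w hw, w_w_eq w hw]; abel

/-- `w ∘ w̄ = 1`: `w (−x − w x) = x`. -/
theorem w_wbar_eq (w : M →+ M) (hw : ∀ x, w (w x) + w x + x = 0) (x : M) : w (-x - w x) = x := by
  simp only [map_sub, map_neg, w_w_eq w hw]; abel

/-- `w̄ ∘ w = 1`: `−(w x) − w (w x) = x`. -/
theorem wbar_w_eq (w : M →+ M) (hw : ∀ x, w (w x) + w x + x = 0) (x : M) : -(w x) - w (w x) = x := by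
  rw [w_w_eq w hw]; abel

/-- `w̄ ∘ w̄ = w`: `−(−x − w x) − w (−x − w x) = w x`. -/
theorem wbar_wbar_eq (w : M →+ M) (hw : ∀ x, w (w x) + w x + x = 0) (x : M) :
    -(-x - w x) - w (-x - w x) = w x := by
  simp only [map_sub, map_neg, w_w_eq w hw]; abel

/-- `σ ∘ w² = w ∘ σ` (conjugating twice: `σ w̄ = w σ`). -/
theorem sigma_w_w (w σ : M →+ M) (hw : ∀ x, w (w x) + w x + x = 0)
    (hσw : ∀ x, σ (w x) = -(σ x) - w (σ x)) (x : M) : σ (w (w x)) = w (σ x) := by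
  rw [hσw, hσw]; simp only [map_neg, map_sub, w_w_eq w hw]; abel

/-! ### §A Cohomological triviality: `Ĥ⁰(C₂, M) = 0` and `H¹(C₂, M) = 0` -/

/-- Every invariant is a norm: `σ s = s ⇒ s = σ y + y` with `y = −w s` (as `ω + ω̄ = −1`). -/
theorem invariant_eq_norm (w σ : M →+ M) (hσw : ∀ x, σ (w x) = -(σ x) - w (σ x))
    {s : M} (hs : σ s = s) : s = σ (-(w s)) + -(w s) := by
  rw [map_neg, hσw, hs]; abel

/-- **`Ĥ⁰(C₂, M) = 0`**: the norm `σ + id` is ONTO the invariants, `range (σ + id) = ker (σ − id)`.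
[memo §64.2 (C4) «`(1 + τ)H = H^τ`, `Tr` onto (`2` unramified)» — replaces McCallum's odd order.] -/
theorem range_add_id_eq_ker_sub_id (w σ : M →+ M) (hσ : ∀ x, σ (σ x) = x)
    (hσw : ∀ x, σ (w x) = -(σ x) - w (σ x)) :
    (σ + AddMonoidHom.id M).range = (σ - AddMonoidHom.id M).ker := by
  ext s
  rw [mem_ker_sub_id_iff, AddMonoidHom.mem_range]
  constructor
  · rintro ⟨y, rfl⟩
    rw [AddMonoidHom.add_apply, AddMonoidHom.id_apply, map_add, hσ, add_comm]
  · intro hs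
    refine ⟨-(w s), ?_⟩
    rw [AddMonoidHom.add_apply, AddMonoidHom.id_apply]
    exact (invariant_eq_norm w σ hσw hs).symm

/-- Every anti-invariant is a coboundary: `σ t = −t ⇒ t = σ y − y` with `y = w t`. -/
theorem antiInvariant_eq_sub (w σ : M →+ M) (hσw : ∀ x, σ (w x) = -(σ x) - w (σ x))
    {t : M} (ht : σ t = -t) : t = σ (w t) - w t := by
  rw [hσw, ht, map_neg]; abel

/-- **`H¹(C₂, M) = 0`**: `range (σ − id) = ker (σ + id)` (every `σ`-anti-invariant is `σ y − y`).
[Behind memo §57.1 (D1): `H¹(K, ·) = H¹(ℚ, ·) ⊗ 𝒪` with no `H¹(Gal(K/ℚ), ·)`-correction.] -/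
theorem range_sub_id_eq_ker_add_id (w σ : M →+ M) (hσ : ∀ x, σ (σ x) = x)
    (hσw : ∀ x, σ (w x) = -(σ x) - w (σ x)) :
    (σ - AddMonoidHom.id M).range = (σ + AddMonoidHom.id M).ker := by
  ext t
  rw [mem_ker_add_id_iff, AddMonoidHom.mem_range]
  constructor
  · rintro ⟨y, rfl⟩
    rw [AddMonoidHom.sub_apply, AddMonoidHom.id_apply, map_sub, hσ]; abel
  · intro ht
    refine ⟨w t, ?_⟩
    rw [AddMonoidHom.sub_apply, AddMonoidHom.id_apply]
    exact (antiInvariant_eq_sub w σ hσw ht).symm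

/-- The module is the `𝒪`-span of its invariants: `S ⊔ w(S) = ⊤` (Part I's descent, subgroup form). -/
theorem invariants_sup_map_w_eq_top (w σ : M →+ M) (hw : ∀ x, w (w x) + w x + x = 0)
    (hσ : ∀ x, σ (σ x) = x) (hσw : ∀ x, σ (w x) = -(σ x) - w (σ x))
    (h3 : Function.Bijective fun x : M => (3 : ℤ) • x) :
    (σ - AddMonoidHom.id M).ker ⊔ ((σ - AddMonoidHom.id M).ker).map w = ⊤ := by
  rw [eq_top_iff]
  intro m _
  obtain ⟨⟨s, t⟩, hst⟩ := descent_surjective w σ hw hσ hσw h3 m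
  simp only at hst
  rw [← hst]
  exact AddSubgroup.add_mem_sup s.2 (AddSubgroup.mem_map_of_mem w t.2)

/-! ### §B Unit eigenlines (memo §57.1 (D2)) -/

/-- `u = ω`: `σ x = w x ↔ x = w s` for an invariant `s` (namely `s = w² x`). -/
theorem sigma_eq_w_iff (w σ : M →+ M) (hw : ∀ x, w (w x) + w x + x = 0)
    (hσw : ∀ x, σ (w x) = -(σ x) - w (σ x)) (x : M) :
    σ x = w x ↔ ∃ s, σ s = s ∧ x = w s := by
  constructor
  · intro hx
    refine ⟨w (w x), ?_, (w_w_w_eq w hw x).symm⟩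
    rw [sigma_w_w w σ hw hσw, hx]
  · rintro ⟨s, hs, rfl⟩
    rw [hσw, hs, w_w_eq w hw]

/-- `u = ω̄`: `σ x = w̄ x ↔ x = w̄ s` for an invariant `s` (`w̄ y = −y − w y`). -/
theorem sigma_eq_wbar_iff (w σ : M →+ M) (hw : ∀ x, w (w x) + w x + x = 0)
    (hσw : ∀ x, σ (w x) = -(σ x) - w (σ x)) (x : M) :
    σ x = -x - w x ↔ ∃ s, σ s = s ∧ x = -s - w s := by
  constructor
  · intro hx
    refine ⟨w x, ?_, ?_⟩
    · rw [hσw, hx]; exact wbar_wbar_eq w hw x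
    · rw [w_w_eq w hw]; abel
  · rintro ⟨s, hs, rfl⟩
    simp only [map_sub, map_neg, hσw, hs, w_w_eq w hw]; abel

/-- `u = −ω`: `σ x = −w x ↔ x = w t` for an ANTI-invariant `t` (with Part I's `T = θ S`: `= ωθ·S`). -/
theorem sigma_eq_neg_w_iff (w σ : M →+ M) (hw : ∀ x, w (w x) + w x + x = 0)
    (hσw : ∀ x, σ (w x) = -(σ x) - w (σ x)) (x : M) :
    σ x = -(w x) ↔ ∃ t, σ t = -t ∧ x = w t := by
  constructor
  · intro hx
    refine ⟨w (w x), ?_, (w_w_w_eq w hw x).symm⟩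
    rw [sigma_w_w w σ hw hσw, hx, map_neg]
  · rintro ⟨t, ht, rfl⟩
    rw [hσw, ht, map_neg, w_w_eq w hw]; abel

/-- `u = −ω̄`: `σ x = −w̄ x ↔ x = w̄ t` for an anti-invariant `t`. -/
theorem sigma_eq_neg_wbar_iff (w σ : M →+ M) (hw : ∀ x, w (w x) + w x + x = 0)
    (hσw : ∀ x, σ (w x) = -(σ x) - w (σ x)) (x : M) :
    σ x = -(-x - w x) ↔ ∃ t, σ t = -t ∧ x = -t - w t := by
  constructor
  · intro hx
    refine ⟨w x, ?_, ?_⟩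
    · rw [hσw, hx]; simp only [map_neg, map_sub, w_w_eq w hw]; abel
    · rw [w_w_eq w hw]; abel
  · rintro ⟨t, ht, rfl⟩
    simp only [map_sub, map_neg, hσw, ht, w_w_eq w hw]; abel

/-! ### §C The `𝒪`-sesquilinear refinement of an `𝒪`-balanced pairing
`B : M →+ M →+ Q` with `B (w a) b = B a (w̄ b)`; `R₀ a b := B a b − B (w a) b`,
`R₁ a b := −B a b − 2 • B (w a) b`, `((a, b)) := R₀ + ω R₁ ∈ Q ⊕ ωQ` (displayed, never defined). -/

section Pairing
variable {Q : Type*} [AddCommGroup Q]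

/-- TRACE IDENTITY: `Tr((a,b)) = 2R₀ − R₁ = 3·B(a,b)` (`Tr(x + ωy) = 2x − y`). -/
theorem trace_refine (w : M →+ M) (B : M →+ M →+ Q) (a b : M) :
    2 • (B a b - B (w a) b) - (-(B a b) - 2 • B (w a) b) = 3 • B a b := by
  abel

/-- LEFT `ω`-LINEARITY `((ωa, b)) = ω((a,b))`: `R₀(ωa,b) = −R₁(a,b)`, `R₁(ωa,b) = R₀(a,b) − R₁(a,b)`. -/
theorem refine_left_w (w : M →+ M) (hw : ∀ x, w (w x) + w x + x = 0) (B : M →+ M →+ Q) (a b : M) :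
    (B (w a) b - B (w (w a)) b = -(-(B a b) - 2 • B (w a) b)) ∧
      (-(B (w a) b) - 2 • B (w (w a)) b = (B a b - B (w a) b) - (-(B a b) - 2 • B (w a) b)) := by
  simp only [w_w_eq w hw, map_sub, map_neg, AddMonoidHom.sub_apply, AddMonoidHom.neg_apply]
  constructor <;> abel

/-- Balancedness moves `ω` to the right as `ω̄² = ω`: `B(a, ωb) = B(ω²a, b) = −B(a,b) − B(ωa,b)`. -/
theorem pairing_right_w (w : M →+ M) (hw : ∀ x, w (w x) + w x + x = 0) (B : M →+ M →+ Q)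
    (hB : ∀ a b, B (w a) b = B a (-b - w b)) (a b : M) :
    B a (w b) = -(B a b) - B (w a) b := by
  have h1 : B a (w b) = B (w (w a)) b := by
    rw [hB (w a) b, hB a, wbar_wbar_eq w hw]
  rw [h1]
  simp only [w_w_eq w hw, map_sub, map_neg, AddMonoidHom.sub_apply, AddMonoidHom.neg_apply]

/-- RIGHT `ω̄`-LINEARITY `((a, ωb)) = ω̄((a,b))`: `R₀(a,ωb) = R₁(a,b) − R₀(a,b)`, `R₁(a,ωb) = −R₀(a,b)`. -/
theorem refine_right_w (w : M →+ M) (hw : ∀ x, w (w x) + w x + x = 0) (B : M →+ M →+ Q)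
    (hB : ∀ a b, B (w a) b = B a (-b - w b)) (a b : M) :
    (B a (w b) - B (w a) (w b) = (-(B a b) - 2 • B (w a) b) - (B a b - B (w a) b)) ∧
      (-(B a (w b)) - 2 • B (w a) (w b) = -(B a b - B (w a) b)) := by
  have h1 := pairing_right_w w hw B hB a b
  have h2 : B (w a) (w b) = B a b := by
    rw [hB a (w b), wbar_w_eq w hw]
  rw [h1, h2]
  constructor <;> abel

/-- SKEW-HERMITIAN from ALTERNATING: `B(b,a) = −B(a,b) ⇒ ((b,a)) = −conj((a,b))`, i.e.
`R₀(b,a) = R₁(a,b) − R₀(a,b)`, `R₁(b,a) = R₁(a,b)` [memo §59.1 (i) «perfect and skew-hermitian»]. -/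
theorem refine_swap_of_alternating (w : M →+ M) (hw : ∀ x, w (w x) + w x + x = 0) (B : M →+ M →+ Q)
    (hB : ∀ a b, B (w a) b = B a (-b - w b)) (halt : ∀ a b, B b a = -(B a b)) (a b : M) :
    (B b a - B (w b) a = (-(B a b) - 2 • B (w a) b) - (B a b - B (w a) b)) ∧
      (-(B b a) - 2 • B (w b) a = -(B a b) - 2 • B (w a) b) := by
  have h1 : B (w b) a = B a b + B (w a) b := by
    rw [halt a (w b), pairing_right_w w hw B hB]; abel
  rw [halt a b, h1]
  constructor <;> abel

/-- UNIQUENESS: a candidate value `x + ωy` at `(a,b)` with the right trace, whose `ω`-multiple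
`−y + ω(x − y)` has the right trace at `(ωa, b)`, equals `(R₀, R₁)(a,b)` (`3` injective on `Q`). -/
theorem refine_unique (w : M →+ M) (B : M →+ M →+ Q)
    (h3Q : Function.Injective fun q : Q => (3 : ℤ) • q) (a b : M) (x y : Q)
    (htr : 2 • x - y = 3 • B a b) (htrw : 2 • (-y) - (x - y) = 3 • B (w a) b) :
    x = B a b - B (w a) b ∧ y = -(B a b) - 2 • B (w a) b := by
  have hx : (3 : ℤ) • x = (3 : ℤ) • (B a b - B (w a) b) := by
    have e : (3 : ℤ) • x = (2 • x - y) - (2 • (-y) - (x - y)) := by module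
    rw [e, htr, htrw]; module
  have hx' : x = B a b - B (w a) b := h3Q hx
  refine ⟨hx', ?_⟩
  have e : y = 2 • x - (2 • x - y) := by abel
  rw [e, htr, hx']; module

/-- UNIT ADJUSTMENT / KERNEL AGREEMENT: `((a,b)) = 0 ↔ B(a,b) = 0 ∧ B(ωa,b) = 0` (`3` injective on
`Q`). [memo §64.1 (P6), §64.4 (13): `Tr((d,y))` may vanish while `((d,y)) ≠ 0` («`Tr(1/2) ≡ 0`»), but
then `B([u]d, y) ≠ 0` for some `u ∈ μ₃` — replace the class by its `[u]`-multiple.] -/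
theorem refine_eq_zero_iff (w : M →+ M) (B : M →+ M →+ Q)
    (h3Q : Function.Injective fun q : Q => (3 : ℤ) • q) (a b : M) :
    (B a b - B (w a) b = 0 ∧ -(B a b) - 2 • B (w a) b = 0) ↔ (B a b = 0 ∧ B (w a) b = 0) := by
  constructor
  · rintro ⟨h0, h1⟩
    have h3 : (3 : ℤ) • B a b = (3 : ℤ) • (0 : Q) := by
      have e : (3 : ℤ) • B a b = 2 • (B a b - B (w a) b) - (-(B a b) - 2 • B (w a) b) := by module
      rw [e, h0, h1]; simp
    have hab : B a b = 0 := h3Q h3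
    refine ⟨hab, ?_⟩
    rw [hab, zero_sub, neg_eq_zero] at h0
    exact h0
  · rintro ⟨h0, h1⟩
    rw [h0, h1]; simp

/-- LEFT KERNELS AGREE: `((a, ·)) = 0 ↔ B(a, ·) = 0` (`B` balanced, `3` injective on `Q`): the
refinement is non-degenerate iff `B` is [memo §59.1 (i) «it is perfect»]. -/
theorem refine_left_kernel_iff (w : M →+ M) (B : M →+ M →+ Q)
    (hB : ∀ a b, B (w a) b = B a (-b - w b))
    (h3Q : Function.Injective fun q : Q => (3 : ℤ) • q) (a : M) :
    (∀ b, B a b - B (w a) b = 0 ∧ -(B a b) - 2 • B (w a) b = 0) ↔ ∀ b, B a b = 0 := by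
  constructor
  · intro h b
    exact ((refine_eq_zero_iff w B h3Q a b).mp (h b)).1
  · intro h b
    refine (refine_eq_zero_iff w B h3Q a b).mpr ⟨h b, ?_⟩
    rw [hB, h]

/-- RIGHT KERNELS AGREE: `((·, b)) = 0 ↔ B(·, b) = 0` (`3` injective on `Q`). -/
theorem refine_right_kernel_iff (w : M →+ M) (B : M →+ M →+ Q)
    (h3Q : Function.Injective fun q : Q => (3 : ℤ) • q) (b : M) :
    (∀ a, B a b - B (w a) b = 0 ∧ -(B a b) - 2 • B (w a) b = 0) ↔ ∀ a, B a b = 0 := by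
  constructor
  · intro h a
    exact ((refine_eq_zero_iff w B h3Q a b).mp (h a)).1
  · intro h a
    exact (refine_eq_zero_iff w B h3Q a b).mpr ⟨h a, h (w a)⟩

/-! ### §D Base-changed Lagrangians (memo §59.1 (iii)) -/

/-- `B(a + ωc, a' + ωc') = B(a,a') + B(a,ωc') − B(c,a') − B(c,ωa') + B(c,c')` for balanced `B`. -/
theorem pairing_descent_expand (w : M →+ M) (hw : ∀ x, w (w x) + w x + x = 0) (B : M →+ M →+ Q)
    (hB : ∀ a b, B (w a) b = B a (-b - w b)) (a c a' c' : M) :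
    B (a + w c) (a' + w c') = B a a' + B a (w c') - B c a' - B c (w a') + B c c' := by
  have h1 : B (w c) a' = -(B c a') - B c (w a') := by
    rw [hB]; simp only [map_sub, map_neg]
  have h2 : B (w c) (w c') = B c c' := by
    rw [hB, wbar_w_eq w hw]
  simp only [map_add, AddMonoidHom.add_apply, h1, h2]
  abel

/-- ISOTROPY TRANSFERS: `B(D₀, D₀) = B(D₀, ωD₀) = 0 ⇒` the `𝒪`-span `D₀ ⊔ ω(D₀)` is `B`-isotropic. -/
theorem isotropic_sup_map_w (w : M →+ M) (hw : ∀ x, w (w x) + w x + x = 0) (B : M →+ M →+ Q)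
    (hB : ∀ a b, B (w a) b = B a (-b - w b)) (D₀ : AddSubgroup M)
    (h00 : ∀ x ∈ D₀, ∀ y ∈ D₀, B x y = 0) (h0w : ∀ x ∈ D₀, ∀ y ∈ D₀, B x (w y) = 0) :
    ∀ x ∈ D₀ ⊔ D₀.map w, ∀ y ∈ D₀ ⊔ D₀.map w, B x y = 0 := by
  intro x hx y hy
  obtain ⟨a, ha, b, hb, rfl⟩ := AddSubgroup.mem_sup.mp hx
  obtain ⟨c, hc, rfl⟩ := AddSubgroup.mem_map.mp hb
  obtain ⟨a', ha', b', hb', rfl⟩ := AddSubgroup.mem_sup.mp hy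
  obtain ⟨c', hc', rfl⟩ := AddSubgroup.mem_map.mp hb'
  rw [pairing_descent_expand w hw B hB, h00 a ha a' ha', h0w a ha c' hc', h00 c hc a' ha',
    h0w c hc a' ha', h00 c hc c' hc']
  simp

/-- The `𝒪`-span `D₀ ⊔ ω(D₀)` is `ω`-stable (an `𝒪`-submodule): `ω(a + ωc) = −c + ω(a − c)`. -/
theorem map_w_sup_map_w_le (w : M →+ M) (hw : ∀ x, w (w x) + w x + x = 0) (D₀ : AddSubgroup M) :
    (D₀ ⊔ D₀.map w).map w ≤ D₀ ⊔ D₀.map w := by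
  rintro x hx
  obtain ⟨y, hy, rfl⟩ := AddSubgroup.mem_map.mp hx
  obtain ⟨a, ha, b, hb, rfl⟩ := AddSubgroup.mem_sup.mp hy
  obtain ⟨c, hc, rfl⟩ := AddSubgroup.mem_map.mp hb
  have e : w (a + w c) = -c + w (a - c) := by
    rw [map_add, w_w_eq w hw, map_sub]; abel
  rw [e]
  exact AddSubgroup.add_mem_sup (neg_mem hc) (AddSubgroup.mem_map_of_mem w (sub_mem ha hc))

/-- The `𝒪`-span of a subgroup of INVARIANTS is `σ`-stable: `σ(a + ωc) = (a − c) + ω(−c)`. -/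
theorem map_sigma_sup_map_w_le (w σ : M →+ M) (hσw : ∀ x, σ (w x) = -(σ x) - w (σ x))
    (D₀ : AddSubgroup M) (hD : D₀ ≤ (σ - AddMonoidHom.id M).ker) :
    (D₀ ⊔ D₀.map w).map σ ≤ D₀ ⊔ D₀.map w := by
  rintro x hx
  obtain ⟨y, hy, rfl⟩ := AddSubgroup.mem_map.mp hx
  obtain ⟨a, ha, b, hb, rfl⟩ := AddSubgroup.mem_sup.mp hy
  obtain ⟨c, hc, rfl⟩ := AddSubgroup.mem_map.mp hb
  have hσa : σ a = a := (mem_ker_sub_id_iff σ a).mp (hD ha)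
  have hσc : σ c = c := (mem_ker_sub_id_iff σ c).mp (hD hc)
  have e : σ (a + w c) = (a - c) + w (-c) := by
    rw [map_add, hσw, hσa, hσc, map_neg]; abel
  rw [e]
  exact AddSubgroup.add_mem_sup (sub_mem ha hc) (AddSubgroup.mem_map_of_mem w (neg_mem hc))

/-- ORDER OF THE `𝒪`-SPAN: for `D₀ ≤ S` (`3` bijective), `(a, c) ↦ a + ωc` is a bijection
`D₀ × D₀ → D₀ ⊔ ω(D₀)` (Part I's descent restricted), so `#(D₀ ⊔ ω(D₀)) = #D₀²` [memo §59.1 (iii)]. -/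
theorem card_sup_map_w_eq_sq (w σ : M →+ M) (hw : ∀ x, w (w x) + w x + x = 0)
    (hσw : ∀ x, σ (w x) = -(σ x) - w (σ x))
    (h3 : Function.Bijective fun x : M => (3 : ℤ) • x)
    (D₀ : AddSubgroup M) (hD : D₀ ≤ (σ - AddMonoidHom.id M).ker) :
    Nat.card ↥(D₀ ⊔ D₀.map w) = Nat.card D₀ ^ 2 := by
  let Φ : D₀ × D₀ →+ M := D₀.subtype.coprod (w.comp D₀.subtype)
  have hΦ' : ∀ st : D₀ × D₀, Φ st = (st.1 : M) + w st.2 := by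
    intro st
    simp only [Φ, AddMonoidHom.coprod_apply, AddSubgroup.coe_subtype, AddMonoidHom.coe_comp,
      Function.comp_apply]
  have hinj : Function.Injective Φ := by
    intro ⟨s, t⟩ ⟨s', t'⟩ hst
    rw [hΦ', hΦ'] at hst
    have key := descent_injective w σ hw hσw h3
      (a₁ := (⟨s, hD s.2⟩, ⟨t, hD t.2⟩)) (a₂ := (⟨s', hD s'.2⟩, ⟨t', hD t'.2⟩)) (by simpa using hst)
    simp only [Prod.mk.injEq, Subtype.mk.injEq] at key
    exact Prod.ext (Subtype.ext key.1) (Subtype.ext key.2)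
  have hrange : Φ.range = D₀ ⊔ D₀.map w := by
    ext x
    rw [AddMonoidHom.mem_range]
    constructor
    · rintro ⟨st, rfl⟩
      rw [hΦ']
      exact AddSubgroup.add_mem_sup st.1.2 (AddSubgroup.mem_map_of_mem w st.2.2)
    · intro hx
      obtain ⟨a, ha, b, hb, rfl⟩ := AddSubgroup.mem_sup.mp hx
      obtain ⟨c, hc, rfl⟩ := AddSubgroup.mem_map.mp hb
      exact ⟨(⟨a, ha⟩, ⟨c, hc⟩), hΦ' _⟩
  rw [← hrange, Nat.card_congr (AddMonoidHom.ofInjective hinj).symm.toEquiv, Nat.card_prod, sq]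

/-- MAXIMAL ISOTROPIC SIZE: with Part I's `#M = #S²`, a `D₀ ≤ S` of Lagrangian size `#D₀² = #S`
spans an `𝒪`-submodule with `#(D₀ ⊔ ω(D₀))² = #M` [memo §59.1 (iii) «of order `√#𝒜_X`»]. -/
theorem card_sup_map_w_sq_eq_card (w σ : M →+ M) (hw : ∀ x, w (w x) + w x + x = 0)
    (hσ : ∀ x, σ (σ x) = x) (hσw : ∀ x, σ (w x) = -(σ x) - w (σ x))
    (h3 : Function.Bijective fun x : M => (3 : ℤ) • x)
    (D₀ : AddSubgroup M) (hD : D₀ ≤ (σ - AddMonoidHom.id M).ker)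
    (hL : Nat.card D₀ ^ 2 = Nat.card (σ - AddMonoidHom.id M).ker) :
    Nat.card ↥(D₀ ⊔ D₀.map w) ^ 2 = Nat.card M := by
  rw [card_sup_map_w_eq_sq w σ hw hσw h3 D₀ hD, hL,
    card_eq_card_invariants_sq w σ hw hσ hσw h3]

end Pairing

end Summit.BirchSwinnertonDyer.BirchSwinnertonDyer.Theorems.SylvesterTwoUnramifiedPairings
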